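import Mathlib
import Summits.Ventures.HodgeRepro2.T5MeasureSupOnClopens
import Summits.Ventures.HodgeRepro2.T5LocallyConstantDetermines
import Summits.Ventures.HodgeRepro2.T5MuInvariantPadic
import Summits.Ventures.HodgeRepro2.T5PushforwardMeasure
import Summits.Ventures.HodgeRepro2.T5PropGArithmetic
import Summits.Ventures.HodgeRepro2.T5LambdaInvariantDVR

/-!
# T5MuInvariantDVR — the μ-invariant «inf over opens» of a measure with values in a complete
discrete valuation ring (W = W(𝔽̄_p)), in the valuation vocabulary

Tier-5 support for route-3's §G (route/T5-CHECK-G-p7.md §3 S1 / S4, §21.1): Hsieh's and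
Burungale–Hida's μ-invariant of a W-valued measure φ on a profinite group is
μ(φ) = inf_U v_p(φ(U)) over the open (= clopen) subsets U.  T5MuInvariantPadic (§56) proved its
properties for ℤ_p-VALUED measures, with v_p = `PadicInt.valuation`; the Katz measures are W-valued
(W the Witt vectors of 𝔽̄_p, a complete DVR with uniformiser p — CHECK-G §21.7 / §21.8).  This file
re-does §56 for measures with values in ANY discrete valuation ring A whose norm is a function of
the valuation (`NormDict A r`: ‖x‖ ≤ r ^ n ↔ n ≤ v(x), with v = Mathlib's `addVal`), and proves

* `muV_eq_top_iff_eq_zero` — S1: μ(φ) = ∞ ⟺ φ(U) = 0 for every open U ⟺ φ = 0;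
* `iInf_addVal_apply_eq_muV` — S4: the inf over opens is the inf over all of C(X, A);
* `muV_twist` — S4: μ(ν̃·m) = μ(m) for a unit-valued continuous ν̃;
* `muV_le_muV_pushforward` — S1: μ(m) ≤ μ(π_*m) along any continuous map, so that
  Burungale–Hida's [P2] «μ(L⁻) = μ(L⁻_𝔭)» asserts exactly the reverse inequality, and
  `pushforward_ne_zero_of_muV_eq` (m ≠ 0 and [P2] ⇒ π_*m ≠ 0);
* `muV_eq_mu` — on ℤ_p the new invariant is §56's, and `NormDict.padicInt`: ℤ_p satisfies the
  dictionary with r = p⁻¹.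

No printed input is consumed.  §8(d): uses an L-value-free non-vanishing device: NO.
-/

namespace Summit.Ventures.HodgeRepro2.T5MuInvariantDVR

open Summit.Ventures.HodgeRepro2.T5MeasureSupOnClopens
open Summit.Ventures.HodgeRepro2.T5PushforwardMeasure (pushforward pushforward_apply
  norm_pushforward_le)
open IsDiscreteValuationRing (addVal)

section Dictionary

variable (A : Type*) [NormedCommRing A] [IsDomain A] [IsDiscreteValuationRing A]

/-- The dictionary between the norm of a discrete valuation ring `A` and its valuation
`addVal A`: for a fixed `0 ≤ r` (the absolute value of a uniformiser; `p⁻¹` for ℤ_p or W),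
`‖x‖ ≤ r ^ n ↔ n ≤ v(x)`.  This is the only link between the metric vocabulary of the measure
files (bounded functionals on `C(X, A)`) and the valuation vocabulary of the μ-invariant. -/
structure NormDict (r : ℝ) : Prop where
  /-- `0 ≤ r`. -/
  nonneg : 0 ≤ r
  /-- `‖x‖ ≤ r ^ n ↔ n ≤ addVal A x`. -/
  norm_le_pow_iff : ∀ (x : A) (n : ℕ), ‖x‖ ≤ r ^ n ↔ (n : ℕ∞) ≤ addVal A x

variable {A}

/-- Under the dictionary `A` is integral: every norm is ≤ 1 (the case `n = 0`). -/
theorem NormDict.norm_le_one {r : ℝ} (hd : NormDict A r) (x : A) : ‖x‖ ≤ 1 := by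
  simpa using (hd.norm_le_pow_iff x 0).2 (by simp)

/-- `ℤ_p` satisfies the dictionary with `r = p⁻¹`: `‖x‖ ≤ p^{-n} ↔ n ≤ v_p(x)`
(§56's `norm_le_pow_iff`, with `v_p = addVal ℤ_[p]` by §83's `vp_eq_addVal`). -/
theorem NormDict.padicInt (p : ℕ) [Fact (Nat.Prime p)] : NormDict ℤ_[p] ((p : ℝ)⁻¹) where
  nonneg := by positivity
  norm_le_pow_iff x n := by
    rw [← T5LambdaInvariantDVR.vp_eq_addVal, ← T5MuInvariantPadic.norm_le_pow_iff, inv_pow,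
      zpow_neg, zpow_natCast]

end Dictionary

section Mu

variable {X : Type*} [TopologicalSpace X]
variable {A : Type*} [NormedCommRing A] [IsDomain A] [IsDiscreteValuationRing A]

/-- The μ-invariant «inf over opens» of an `A`-valued measure `m` on `X` (a linear functional on
`C(X, A)`): `μ(m) := ⨅_{U clopen} v(m(1_U))`, with `v = addVal A` — Hsieh's / Burungale–Hida's
`μ(φ) = inf_U v_p(φ(U))` for a W-valued measure (CHECK-G §3 S1 / S4). -/
noncomputable def muV (m : C(X, A) →ₗ[A] A) : ℕ∞ :=
  ⨅ U : {U : Set X // IsClopen U}, addVal A (m (indicatorCM (U : Set X)))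

/-- `μ(m) ≤ v(m(1_U))` for every clopen `U`. -/
theorem muV_le (m : C(X, A) →ₗ[A] A) {U : Set X} (hU : IsClopen U) :
    muV m ≤ addVal A (m (indicatorCM U)) :=
  iInf_le (fun U : {U : Set X // IsClopen U} => addVal A (m (indicatorCM (U : Set X)))) ⟨U, hU⟩

/-- `n ≤ μ(m)` iff `n ≤ v(m(1_U))` for every clopen `U`. -/
theorem natCast_le_muV_iff (m : C(X, A) →ₗ[A] A) (n : ℕ) :
    (n : ℕ∞) ≤ muV m ↔ ∀ U : Set X, IsClopen U → (n : ℕ∞) ≤ addVal A (m (indicatorCM U)) := by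
  unfold muV
  rw [le_iInf_iff]
  exact ⟨fun h U hU => h ⟨U, hU⟩, fun h U => h U.1 U.2⟩

/-- S1, first half: `μ(m) = ∞` iff `m(1_U) = 0` for every clopen `U`
(T5PropGArithmetic's abstract `mu_eq_top_iff` with `v = addVal A`). -/
theorem muV_eq_top_iff (m : C(X, A) →ₗ[A] A) :
    muV m = ⊤ ↔ ∀ U : Set X, IsClopen U → m (indicatorCM U) = 0 :=
  (T5PropGArithmetic.mu_eq_top_iff (addVal A)
    (fun _ => IsDiscreteValuationRing.addVal_eq_top_iff)
    (fun U : {U : Set X // IsClopen U} => m (indicatorCM (U : Set X)))).trans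
    ⟨fun h U hU => h ⟨U, hU⟩, fun h U => h U.1 U.2⟩

variable [CompactSpace X] [T2Space X] [TotallyDisconnectedSpace X]

omit [IsDomain A] [IsDiscreteValuationRing A] in
/-- A bounded `A`-valued measure on a profinite space vanishing on every clopen set is zero
(§59's `eq_of_forall_indicator` against the zero functional). -/
theorem eq_zero_of_forall_indicator_eq_zero (m : C(X, A) →ₗ[A] A) {C : ℝ} (hC : 0 ≤ C)
    (hm : ∀ φ : C(X, A), ‖m φ‖ ≤ C * ‖φ‖)
    (h : ∀ U : Set X, IsClopen U → m (indicatorCM U) = 0) : m = 0 :=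
  T5LocallyConstantDetermines.eq_of_forall_indicator m 0 hC hm
    (fun φ => by
      simp only [LinearMap.zero_apply, norm_zero]
      exact mul_nonneg hC (norm_nonneg φ))
    (fun U hU => by simp only [LinearMap.zero_apply]; exact h U hU)

/-- S1: `μ(m) = ∞ ⟺ m = 0` for a bounded measure on a profinite space. -/
theorem muV_eq_top_iff_eq_zero (m : C(X, A) →ₗ[A] A) {C : ℝ} (hC : 0 ≤ C)
    (hm : ∀ φ : C(X, A), ‖m φ‖ ≤ C * ‖φ‖) : muV m = ⊤ ↔ m = 0 := by
  rw [muV_eq_top_iff]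
  exact ⟨fun h => eq_zero_of_forall_indicator_eq_zero m hC hm h,
    fun h U _ => by simp only [h, LinearMap.zero_apply]⟩

/-- `μ(m) < ∞ ⇒ m ≠ 0`: the form in which S1 is consumed (a measure of finite μ-invariant is
non-zero). -/
theorem ne_zero_of_muV_lt_top (m : C(X, A) →ₗ[A] A) {C : ℝ} (hC : 0 ≤ C)
    (hm : ∀ φ : C(X, A), ‖m φ‖ ≤ C * ‖φ‖) (h : muV m < ⊤) : m ≠ 0 := by
  intro h0
  exact h.ne ((muV_eq_top_iff_eq_zero m hC hm).2 h0)

variable [IsUltrametricDist A]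

/-- The valuation bound on clopen indicators propagates to all of `C(X, A)`: if
`n ≤ v(m(1_U))` for every clopen `U` then `n ≤ v(m φ)` for every continuous `φ` — §55's
`norm_apply_le_of_forall_indicator_le` read through the dictionary with `S = r ^ n`. -/
theorem natCast_le_addVal_apply {r : ℝ} (hd : NormDict A r) (m : C(X, A) →ₗ[A] A) {C : ℝ}
    (hC : 0 ≤ C) (hm : ∀ φ : C(X, A), ‖m φ‖ ≤ C * ‖φ‖) (n : ℕ)
    (h : ∀ U : Set X, IsClopen U → (n : ℕ∞) ≤ addVal A (m (indicatorCM U))) (φ : C(X, A)) :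
    (n : ℕ∞) ≤ addVal A (m φ) := by
  rw [← hd.norm_le_pow_iff]
  exact norm_apply_le_of_forall_indicator_le hd.norm_le_one m hC hm (pow_nonneg hd.nonneg n)
    (fun U hU => (hd.norm_le_pow_iff _ _).2 (h U hU)) φ

/-- S4: «μ = inf over opens = inf over C(Γ⁻, 𝒪)» — the infimum of `v(m φ)` over all continuous
`φ` equals the infimum over clopen indicators. -/
theorem iInf_addVal_apply_eq_muV {r : ℝ} (hd : NormDict A r) (m : C(X, A) →ₗ[A] A) {C : ℝ}
    (hC : 0 ≤ C) (hm : ∀ φ : C(X, A), ‖m φ‖ ≤ C * ‖φ‖) :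
    ⨅ φ : C(X, A), addVal A (m φ) = muV m := by
  apply le_antisymm
  · exact le_iInf fun U => iInf_le (fun φ : C(X, A) => addVal A (m φ)) (indicatorCM (U : Set X))
  · refine le_iInf fun φ => T5MuInvariantPadic.le_of_forall_natCast_le fun n hn => ?_
    exact natCast_le_addVal_apply hd m hC hm n (fun U hU => hn.trans (muV_le m hU)) φ

/-- `n ≤ μ(m)` iff `n ≤ v(m φ)` for every continuous `φ`. -/
theorem natCast_le_muV_iff_forall {r : ℝ} (hd : NormDict A r) (m : C(X, A) →ₗ[A] A) {C : ℝ}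
    (hC : 0 ≤ C) (hm : ∀ φ : C(X, A), ‖m φ‖ ≤ C * ‖φ‖) (n : ℕ) :
    (n : ℕ∞) ≤ muV m ↔ ∀ φ : C(X, A), (n : ℕ∞) ≤ addVal A (m φ) := by
  rw [← iInf_addVal_apply_eq_muV hd m hC hm, le_iInf_iff]

/-- `μ(m)` is the least valuation of a value of `m`, in the norm vocabulary: `n ≤ μ(m)` iff
`‖m φ‖ ≤ r ^ n` for every continuous `φ`. -/
theorem natCast_le_muV_iff_norm_le {r : ℝ} (hd : NormDict A r) (m : C(X, A) →ₗ[A] A) {C : ℝ}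
    (hC : 0 ≤ C) (hm : ∀ φ : C(X, A), ‖m φ‖ ≤ C * ‖φ‖) (n : ℕ) :
    (n : ℕ∞) ≤ muV m ↔ ∀ φ : C(X, A), ‖m φ‖ ≤ r ^ n := by
  rw [natCast_le_muV_iff_forall hd m hC hm]
  exact forall_congr' fun φ => (hd.norm_le_pow_iff _ _).symm

end Mu

section Twist

variable {X : Type*} [TopologicalSpace X]
variable {A : Type*} [NormedCommRing A]

/-- Multiplication by a unit-valued continuous function `ν` (with inverse `ν'`) as a bijection of
`C(X, A)` — the «φ ↦ φν̃ is a bijection of C(Γ⁻, 𝒪)» of S4, for any coefficient ring. -/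
def unitMulEquiv (ν ν' : C(X, A)) (h : ν * ν' = 1) : C(X, A) ≃ C(X, A) where
  toFun φ := ν * φ
  invFun φ := ν' * φ
  left_inv φ := by
    show ν' * (ν * φ) = φ
    rw [← mul_assoc, mul_comm ν' ν, h, one_mul]
  right_inv φ := by
    show ν * (ν' * φ) = φ
    rw [← mul_assoc, h, one_mul]

/-- `unitMulEquiv ν ν' h φ = ν * φ`. -/
@[simp] theorem unitMulEquiv_apply (ν ν' : C(X, A)) (h : ν * ν' = 1) (φ : C(X, A)) :
    unitMulEquiv ν ν' h φ = ν * φ := rfl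

variable [IsDomain A] [IsDiscreteValuationRing A]

/-- The infimum of `v` over the values of the twisted measure `ν̃·m` is that over the values of
`m` (same value set: §7's `mu_twist_invariant` along `unitMulEquiv`). -/
theorem iInf_addVal_twist (ν ν' : C(X, A)) (h : ν * ν' = 1) (m : C(X, A) →ₗ[A] A) :
    ⨅ φ : C(X, A), addVal A ((twist ν m) φ) = ⨅ φ : C(X, A), addVal A (m φ) := by
  have := T5PropGArithmetic.mu_twist_invariant (fun φ : C(X, A) => addVal A (m φ))
    (unitMulEquiv ν ν' h)
  simpa only [unitMulEquiv_apply, twist_apply] using this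

variable [CompactSpace X] [T2Space X] [TotallyDisconnectedSpace X] [IsUltrametricDist A]

/-- S4: «μ(ν̃·m) = μ(m)» for a unit-valued continuous `ν̃` and a bounded `A`-valued measure `m`
on a profinite space — the twist invariance of the μ-invariant over W. -/
theorem muV_twist {r : ℝ} (hd : NormDict A r) (ν ν' : C(X, A)) (h : ν * ν' = 1)
    (m : C(X, A) →ₗ[A] A) {C : ℝ} (hC : 0 ≤ C) (hm : ∀ φ : C(X, A), ‖m φ‖ ≤ C * ‖φ‖) :
    muV (twist ν m) = muV m := by
  rw [← iInf_addVal_apply_eq_muV hd (twist ν m) hC (twist_bound hd.norm_le_one ν m hC hm),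
    ← iInf_addVal_apply_eq_muV hd m hC hm]
  exact iInf_addVal_twist ν ν' h m

end Twist

section Pushforward

variable {X Y : Type*} [TopologicalSpace X] [TopologicalSpace Y]
variable [CompactSpace X] [T2Space X] [TotallyDisconnectedSpace X]
variable [CompactSpace Y] [T2Space Y] [TotallyDisconnectedSpace Y]
variable {A : Type*} [NormedCommRing A] [IsDomain A] [IsDiscreteValuationRing A]

/-- S1 with [P2] as the named hypothesis: if `m ≠ 0` and `μ(π_*m) = μ(m)` then `π_*m ≠ 0`
(§68's `pushforward_ne_zero_of_mu_eq`, now for `A`-valued measures). -/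
theorem pushforward_ne_zero_of_muV_eq (π : C(X, Y))
    (m : C(X, A) →ₗ[A] A) {C : ℝ} (hC : 0 ≤ C) (hm : ∀ φ : C(X, A), ‖m φ‖ ≤ C * ‖φ‖)
    (hne : m ≠ 0) (hP2 : muV (pushforward π m) = muV m) : pushforward π m ≠ 0 := by
  intro h0
  have htop : muV (pushforward π m) = ⊤ :=
    (muV_eq_top_iff_eq_zero (pushforward π m) hC (norm_pushforward_le π m hC hm)).2 h0
  exact hne ((muV_eq_top_iff_eq_zero m hC hm).1 (hP2 ▸ htop))

variable [IsUltrametricDist A]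

/-- S1: `μ(m) ≤ μ(π_*m)` along any continuous `π : X → Y` (every value of `π_*m` is a value of
`m`) — Burungale–Hida's [P2] «μ(L⁻_{Σ,λ}) = μ(L⁻_{Σ,λ,𝔭})» asserts exactly the reverse
inequality for the Katz measure and the projection Γ⁻ → Γ_𝔭. -/
theorem muV_le_muV_pushforward {r : ℝ} (hd : NormDict A r) (π : C(X, Y))
    (m : C(X, A) →ₗ[A] A) {C : ℝ} (hC : 0 ≤ C) (hm : ∀ φ : C(X, A), ‖m φ‖ ≤ C * ‖φ‖) :
    muV m ≤ muV (pushforward π m) := by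
  rw [← iInf_addVal_apply_eq_muV hd m hC hm,
    ← iInf_addVal_apply_eq_muV hd (pushforward π m) hC (norm_pushforward_le π m hC hm)]
  refine le_iInf fun ψ => ?_
  rw [pushforward_apply]
  exact iInf_le (fun φ : C(X, A) => addVal A (m φ)) (ψ.comp π)

/-- `μ(π_*m) < ∞ ⇒ π_*m ≠ 0 ∧ m ≠ 0`: the 𝔭-line measure and the Γ⁻-measure are both non-zero
as soon as the 𝔭-line μ-invariant is finite (no [P2] needed for this direction). -/
theorem ne_zero_of_muV_pushforward_lt_top {r : ℝ} (hd : NormDict A r) (π : C(X, Y))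
    (m : C(X, A) →ₗ[A] A) {C : ℝ} (hC : 0 ≤ C) (hm : ∀ φ : C(X, A), ‖m φ‖ ≤ C * ‖φ‖)
    (h : muV (pushforward π m) < ⊤) : pushforward π m ≠ 0 ∧ m ≠ 0 :=
  ⟨ne_zero_of_muV_lt_top (pushforward π m) hC (norm_pushforward_le π m hC hm) h,
    ne_zero_of_muV_lt_top m hC hm ((muV_le_muV_pushforward hd π m hC hm).trans_lt h)⟩

end Pushforward

section Padic

variable (p : ℕ) [Fact (Nat.Prime p)] {X : Type*} [TopologicalSpace X]

/-- On `ℤ_p` the new invariant is §56's `mu`: `v_p = addVal ℤ_[p]` (§83's `vp_eq_addVal`). -/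
theorem muV_eq_mu (m : C(X, ℤ_[p]) →ₗ[ℤ_[p]] ℤ_[p]) : muV m = T5MuInvariantPadic.mu p m := by
  unfold muV T5MuInvariantPadic.mu
  simp only [T5LambdaInvariantDVR.vp_eq_addVal]

end Padic

end Summit.Ventures.HodgeRepro2.T5MuInvariantDVR
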